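import Literature.AlgebraicGeometry.Limits.SmoothProjectiveModelPrescribedBase
import Literature.AlgebraicGeometry.Limits.LocalizationIsoSpread
import Literature.AlgebraicGeometry.Limits.GenericFibreSpread
import Literature.AlgebraicGeometry.Limits.IdealSheafExtension
import Literature.AlgebraicGeometry.Resolution.SpreadModelTower
import Mathlib.AlgebraicGeometry.Birational.Birational
import HarnessLib

/-!
# Spreading out a birational smooth projective model of the generic fibre of a family
# (EGA IV₃ §8 on the localization diagram `Spec K = lim D(s)`; Stacks 081I, 0C0C, 0AY8)

Topic `Literature/AlgebraicGeometry/Limits`. One theorem, no definition, no named fact. Written by the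
prover seat `hodge-nonav-prover-Bx` (g18, cell `hodge-nonav`) as brick **QF-5a «SPREAD-BIRATIONAL»** of the
programme «Q-FAMILY» (memo `PROGRAMME-Q-FAMILY-Bx-g18.md` §6–§7; `--supports stmt-HodgeConjecture-24190`),
route-agnostic: it turns a RESOLUTION OF SINGULARITIES OF THE GENERIC MEMBER of a family `P → Spec A`
(more generally any smooth projective geometrically irreducible `K`-variety `E` with a `K`-morphism
`ρ : E → P_K` that is an isomorphism over a quasi-compact open `U_K` coming from an open `U ⊆ P`) into a
SMOOTH PROJECTIVE FAMILY over a basic open `D(t) ⊆ Spec A` — one projective `A`-model `Pm ↪ ℙᴺ_A` of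
`E`, proper, smooth of relative dimension `n` and geometrically irreducible over every model of `A[1/t]`
(`exists_projectiveModel_forall_smooth_away`) — whose fibre over every point of `D(t)` with IRREDUCIBLE
`P`-fibre is BIRATIONAL over the residue field to that fibre of `P` (Mathlib `Scheme.BirationalOver`).

`exists_projectiveModel_birational` — statement and proof («common open») in its docstring. The
programme's assembly QF-5b applies it to the universal quaternionic quartic `𝒱 → 𝔸^{CIdx e}` (brick
QF-1) and the resolution of its generic fibre (brick QF-4), then packages `Q8Family.QFamily e`.

Honest scope: general scheme theory (EGA IV₃ §8); nothing here bears on HC.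

## References

* [EGAIV3] A. Grothendieck, J. Dieudonné, EGA IV₃ (1966), Thm. 8.8.2, 8.8.2.5, Thm. 8.10.5.
* [EGAIV4] EGA IV₄ (1967), Prop. 17.7.8.
* [GortzWedhorn2020] U. Görtz, T. Wedhorn, Algebraic Geometry I, 2nd ed. (2020), Cor. 10.64.
* [StacksProject] The Stacks Project, Tags 081I, 0C0C, 0AY8, 01RN.
-/

noncomputable section

set_option backward.isDefEq.respectTransparency false

universe u

open CategoryTheory CategoryTheory.Limits AlgebraicGeometry TopologicalSpace MvPolynomial
  MonoidalCategory CartesianMonoidalCategory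
open Literature.AlgebraicGeometry.Morphisms Literature.AlgebraicGeometry.Motives
open Literature.AlgebraicGeometry.HodgeTheory.SpreadingOutQbar
open Literature.AlgebraicGeometry.Resolution

namespace Literature.AlgebraicGeometry.Limits

attribute [local instance] MvPolynomial.gradedAlgebra

/-- **Spreading out a birational smooth projective model of the generic fibre** (EGA IV₃ 8.8.2.5 ∕
8.10.5, IV₄ 17.7.8; Stacks 081I, 0C0C, 0AY8; Görtz–Wedhorn I Cor. 10.64). Setting: `A` an integrally
closed Noetherian domain with fraction field `K`; `P → Spec A` quasi-compact, quasi-separated and locally of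
finite presentation (the «cover»); `E` a smooth projective geometrically irreducible `K`-variety of dimension
`n` with a `K`-morphism `ρ : E → P_K = P ×_A Spec K`; a quasi-compact open `U ⊆ P` whose generic trace
`U_K` is met by `ρ` and over which `ρ` is an isomorphism (`IsIso (ρ ∣_ U_K)`, e.g. `ρ` a resolution of
singularities of `P_K` and `U_K` inside its isomorphism locus). Conclusion: ONE projective `A`-model
`emb : Pm ↪ ℙᴺ_A` with `f = emb ≫ (ℙᴺ_A → Spec A)`, a cartesian square `E ≅ Pm ×_A Spec K`
(`gen : E → Pm`), and `t ≠ 0` in `A` such that (i) over every model `T` of `A[1/t]` the base change of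
`f` is PROPER, SMOOTH of relative dimension `n` and GEOMETRICALLY IRREDUCIBLE, and (ii) for every field
`L` and every `A`-algebra structure `A → L` inverting `t` (a point of `D(t)`) whose fibre `P ×_A Spec L`
is irreducible, the fibres `Pm ×_A Spec L` and `P ×_A Spec L` are BIRATIONAL over `Spec L` (Mathlib
`Scheme.BirationalOver`). Proof («common open», module docstring of the programme memo §7): the model
and its uniform smoothness are `exists_projectiveModel_forall_smooth_away`; the exceptional closed set
`C = (ρ⁻¹U_K)ᶜ` of `E` spreads to the closed set of `Pm` cut out by `(vanishingIdeal C).map gen`, whose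
complement `W ⊆ Pm` has generic trace exactly `ρ⁻¹U_K` (`comap_map_eq_of_isPullback_generic`, Mathlib
`support_comap`); the `K`-isomorphism `W_K ≅ ρ⁻¹U_K ≅ U_K` of the generic fibres of the `A`-schemes
`W ⊆ Pm` and `U ⊆ P` spreads to an isomorphism over a stage `D(s)`
(`LocApprox.exists_iso_of_iso_tensor_specOver`); `U` meets every fibre over some `D(b)` (Chevalley,
`exists_basicOpen_subset_range`); `t = t₀ s b`; over an `L`-point of `D(t)` the base-changed isomorphism
`W_L ≅ U_L` is a partial isomorphism between dense opens (`U_L ≠ ∅` in the irreducible `P_L`,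
`W_L ≅ U_L ≠ ∅` in the irreducible `Pm_L`, a fibre of the geometrically irreducible family over
`A[1/t₀]`). [cite: EGAIV3, Thm. 8.10.5] [cite: EGAIV4, Prop. 17.7.8] [cite: GortzWedhorn2020, Cor. 10.64 (2), p. 329]
[cite: StacksProject, Tag 0AY8] -/
theorem exists_projectiveModel_birational {A K : Type u} [CommRing A] [IsDomain A]
    [IsNoetherianRing A] [IsIntegrallyClosed A] [Field K] [Algebra A K] [IsFractionRing A K]
    (P : SchemeOver A) [QuasiCompact P.hom] [QuasiSeparated P.hom] [LocallyOfFinitePresentation P.hom]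
    {n : ℕ} {E : SchemeOver K} (hE : IsSmoothProjective n E)
    (ρ : E.left ⟶ (P ⊗ specOver A K).left) (hρ : ρ ≫ (snd P (specOver A K)).left = E.hom)
    (U : P.left.Opens) (hUc : IsCompact (U : Set P.left))
    (hUK : ((ρ ⁻¹ᵁ ((fst P (specOver A K)).left ⁻¹ᵁ U) : E.left.Opens) : Set E.left).Nonempty)
    [IsIso (ρ ∣_ ((fst P (specOver A K)).left ⁻¹ᵁ U))] :
    ∃ (N : ℕ) (Pm : Scheme.{u}) (emb : Pm ⟶ Proj (homogeneousSubmodule (Fin (N + 1)) A))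
      (_ : IsClosedImmersion emb) (gen : E.left ⟶ Pm) (t : A) (_ : t ≠ 0),
      IsPullback gen E.hom (emb ≫ ProjBaseChangeRing.projToSpec (Fin (N + 1)) A)
        (Spec.map (CommRingCat.ofHom (algebraMap A K))) ∧
      (∀ (T : Type u) [CommRing T] [Algebra A T] [IsLocalization.Away t T],
        IsProper (pullback.snd (emb ≫ ProjBaseChangeRing.projToSpec (Fin (N + 1)) A)
          (Spec.map (CommRingCat.ofHom (algebraMap A T)))) ∧
        SmoothOfRelativeDimension n (pullback.snd (emb ≫ ProjBaseChangeRing.projToSpec (Fin (N + 1)) A)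
          (Spec.map (CommRingCat.ofHom (algebraMap A T)))) ∧
        GeometricallyIrreducible (pullback.snd (emb ≫ ProjBaseChangeRing.projToSpec (Fin (N + 1)) A)
          (Spec.map (CommRingCat.ofHom (algebraMap A T))))) ∧
      ∀ (L : Type u) [Field L] [Algebra A L], IsUnit (algebraMap A L t) →
        IrreducibleSpace ↥(pullback P.hom (Spec.map (CommRingCat.ofHom (algebraMap A L)))) →
        Scheme.BirationalOver
          (pullback.snd (emb ≫ ProjBaseChangeRing.projToSpec (Fin (N + 1)) A)
            (Spec.map (CommRingCat.ofHom (algebraMap A L))))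
          (pullback.snd P.hom (Spec.map (CommRingCat.ofHom (algebraMap A L)))) := by
  classical
  -- ### (1) the projective model over `A` (QF-2′)
  obtain ⟨N, Pm, emb, hemb, gen, t₀, ht₀, hPirr, HK, Hloc⟩ :=
    exists_projectiveModel_forall_smooth_away (A := A) (K := K) hE
  haveI := hemb
  haveI : IsProper (ProjBaseChangeRing.projToSpec (Fin (N + 1)) A) :=
    ProjBaseChangeRing.isProper_projToSpec _ A
  obtain ⟨f, hf⟩ : ∃ f : Pm ⟶ Spec (.of A), f = emb ≫ ProjBaseChangeRing.projToSpec (Fin (N + 1)) A :=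
    ⟨_, rfl⟩
  rw [← hf] at HK Hloc
  haveI : IsProper f := by rw [hf]; infer_instance
  haveI : LocallyOfFiniteType f := ‹IsProper f›.toLocallyOfFiniteType
  haveI : IsNoetherianRing (CommRingCat.of A) := ‹IsNoetherianRing A›
  haveI : IsLocallyNoetherian (Spec (CommRingCat.of A)) :=
    (isLocallyNoetherian_Spec (R := CommRingCat.of A)).mpr ‹_›
  haveI : IsLocallyNoetherian Pm := LocallyOfFiniteType.isLocallyNoetherian f
  haveI : CompactSpace Pm := QuasiCompact.compactSpace_of_compactSpace f
  haveI : IsNoetherian Pm := {}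
  set jK : Spec (.of K) ⟶ Spec (.of A) := Spec.map (CommRingCat.ofHom (algebraMap A K)) with hjK
  haveI : QuasiCompact jK := inferInstance
  haveI : QuasiCompact gen := MorphismProperty.of_isPullback HK.flip inferInstance
  -- ### (2) the open `W ⊆ Pm` whose generic trace is the isomorphism locus `ρ⁻¹ U_K`
  let UK : (P ⊗ specOver A K).left.Opens := (fst P (specOver A K)).left ⁻¹ᵁ U
  let C : Closeds E.left := (ρ ⁻¹ᵁ UK).compl
  let Z : Pm.IdealSheafData := (Scheme.IdealSheafData.vanishingIdeal C).map gen
  let W : Pm.Opens := Z.support.compl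
  have hWgen : gen ⁻¹ᵁ W = ρ ⁻¹ᵁ UK := by
    have h1 : (Z.comap gen) = Scheme.IdealSheafData.vanishingIdeal C :=
      comap_map_eq_of_isPullback_generic K f HK _
    have h2 : (Z.comap gen).support = Z.support.preimage gen.continuous :=
      Scheme.IdealSheafData.support_comap Z gen
    rw [h1] at h2
    apply Opens.ext
    have h3 : ((Scheme.IdealSheafData.vanishingIdeal C).support : Set E.left) = C :=
      Scheme.IdealSheafData.coe_support_vanishingIdeal C
    have h4 : (gen ⁻¹ᵁ W : Set E.left) = (gen.base ⁻¹' (Z.support : Set Pm))ᶜ := by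
      rfl
    rw [h4]
    have h5 : gen.base ⁻¹' (Z.support : Set Pm) = (C : Set E.left) := by
      rw [← h3, h2]; rfl
    rw [h5]
    exact compl_compl _
  -- ### (3) the `A`-schemes `P₁ = W ⊆ Pm`, `P₂ = U ⊆ P` and the isomorphism of their generic fibres
  let P₁ : SchemeOver A := Over.mk (W.ι ≫ f)
  let P₂ : SchemeOver A := Over.mk (U.ι ≫ P.hom)
  -- the generic fibres as open subschemes
  have sqP : IsPullback (fst P (specOver A K)).left (snd P (specOver A K)).left P.hom jK :=
    IsPullback.of_hasPullback _ _
  have sq₁ : IsPullback (gen ∣_ W) ((gen ⁻¹ᵁ W).ι ≫ E.hom) (W.ι ≫ f) jK :=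
    (isPullback_morphismRestrict gen W).paste_vert HK
  have sq₂ : IsPullback ((fst P (specOver A K)).left ∣_ U) (UK.ι ≫ (snd P (specOver A K)).left)
      (U.ι ≫ P.hom) jK :=
    (isPullback_morphismRestrict (fst P (specOver A K)).left U).paste_vert sqP
  have sqT₁ : IsPullback (fst P₁ (specOver A K)).left (snd P₁ (specOver A K)).left (W.ι ≫ f) jK :=
    IsPullback.of_hasPullback _ _
  have sqT₂ : IsPullback (fst P₂ (specOver A K)).left (snd P₂ (specOver A K)).left (U.ι ≫ P.hom) jK :=
    IsPullback.of_hasPullback _ _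
  let e₁ : ((gen ⁻¹ᵁ W : E.left.Opens) : Scheme.{u}) ≅ (P₁ ⊗ specOver A K).left :=
    sq₁.isoIsPullback _ _ sqT₁
  let e₂ : ((UK : (P ⊗ specOver A K).left.Opens) : Scheme.{u}) ≅ (P₂ ⊗ specOver A K).left :=
    sq₂.isoIsPullback _ _ sqT₂
  let m : ((gen ⁻¹ᵁ W : E.left.Opens) : Scheme.{u}) ⟶ ((UK : (P ⊗ specOver A K).left.Opens) : Scheme.{u}) :=
    (E.left.isoOfEq hWgen).hom ≫ (ρ ∣_ UK)
  haveI : IsIso m := inferInstance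
  have hm : m ≫ UK.ι = (gen ⁻¹ᵁ W).ι ≫ ρ := by
    change ((E.left.isoOfEq hWgen).hom ≫ (ρ ∣_ UK)) ≫ UK.ι = _
    rw [Category.assoc, morphismRestrict_ι, ← Category.assoc, Scheme.isoOfEq_hom_ι]
  let θl : (P₁ ⊗ specOver A K).left ≅ (P₂ ⊗ specOver A K).left := e₁.symm ≪≫ asIso m ≪≫ e₂
  have hθl : θl.hom ≫ (snd P₂ (specOver A K)).left = (snd P₁ (specOver A K)).left := by
    change (e₁.inv ≫ m ≫ e₂.hom) ≫ (snd P₂ (specOver A K)).left = _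
    rw [Category.assoc, Category.assoc, sq₂.isoIsPullback_hom_snd _ _ sqT₂, ← Category.assoc m, hm,
      Category.assoc, hρ, sq₁.isoIsPullback_inv_snd _ _ sqT₁]
  have hw₁ : (P₁ ⊗ specOver A K).hom = (snd P₁ (specOver A K)).left ≫ jK :=
    (Over.w (snd P₁ (specOver A K))).symm
  have hw₂ : (P₂ ⊗ specOver A K).hom = (snd P₂ (specOver A K)).left ≫ jK :=
    (Over.w (snd P₂ (specOver A K))).symm
  let θ : P₁ ⊗ specOver A K ≅ P₂ ⊗ specOver A K :=
    Over.isoMk θl (by rw [hw₁, hw₂, ← Category.assoc, hθl])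
  have hθ : θ.hom ≫ snd P₂ (specOver A K) = snd P₁ (specOver A K) := by
    ext : 1
    exact hθl
  -- ### (4) the instances and the spread isomorphism over a stage `D(s)`
  haveI : QuasiSeparatedSpace P.left := quasiSeparatedSpace_of_quasiSeparated P.hom
  haveI : QuasiCompact U.ι := quasiCompact_ι_of_isCompact U hUc
  haveI : QuasiCompact W.ι := quasiCompact_ι_of_isCompact W ((isCompact_iff_compactSpace.mpr inferInstance))
  haveI : LocallyOfFinitePresentation f := LocallyOfFinitePresentation.iff_locallyOfFiniteType.mpr ‹_›
  haveI : QuasiCompact P₁.hom := inferInstanceAs (QuasiCompact (W.ι ≫ f))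
  haveI : QuasiSeparated P₁.hom := inferInstanceAs (QuasiSeparated (W.ι ≫ f))
  haveI : LocallyOfFinitePresentation P₁.hom := inferInstanceAs (LocallyOfFinitePresentation (W.ι ≫ f))
  haveI : QuasiCompact P₂.hom := inferInstanceAs (QuasiCompact (U.ι ≫ P.hom))
  haveI : QuasiSeparated P₂.hom := inferInstanceAs (QuasiSeparated (U.ι ≫ P.hom))
  haveI : LocallyOfFinitePresentation P₂.hom := inferInstanceAs (LocallyOfFinitePresentation (U.ι ≫ P.hom))
  obtain ⟨s, e, he⟩ := LocApprox.exists_iso_of_iso_tensor_specOver (nonZeroDivisors A) K θ hθ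
  -- ### (5) `U` meets every fibre over some `D(b)`
  obtain ⟨b, hb0, hbU⟩ : ∃ b : A, b ≠ 0 ∧
      (PrimeSpectrum.basicOpen b : Set (PrimeSpectrum A)) ⊆ Set.range P₂.hom := by
    refine exists_basicOpen_subset_range P₂.hom ?_
    obtain ⟨x, hx⟩ := hUK
    have hxU : (fst P (specOver A K)).left (ρ x) ∈ U := hx
    refine ⟨⟨(fst P (specOver A K)).left (ρ x), hxU⟩, ?_⟩
    have hjKpt : ∀ z : Spec (.of K), jK z = (⊥ : PrimeSpectrum A) := by
      intro z
      apply PrimeSpectrum.ext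
      change Ideal.comap (algebraMap A K) z.asIdeal = ⊥
      rw [Ideal.eq_bot_of_prime z.asIdeal, ← RingHom.ker_eq_comap_bot]
      exact (RingHom.injective_iff_ker_eq_bot _).mp (IsFractionRing.injective A K)
    have h1 : P₂.hom ⟨(fst P (specOver A K)).left (ρ x), hxU⟩ =
        P.hom ((fst P (specOver A K)).left (ρ x)) := by
      change (U.ι ≫ P.hom) _ = _
      rw [Scheme.Hom.comp_apply]
      rfl
    have h2 : P.hom ((fst P (specOver A K)).left (ρ x)) = jK ((snd P (specOver A K)).left (ρ x)) := by
      rw [← Scheme.Hom.comp_apply, sqP.w, Scheme.Hom.comp_apply]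
      rfl
    rw [h1, h2, hjKpt]
  -- ### (6) the final open `D(t)`, `t = t₀ · s · b`
  have hs0 : s.val ≠ 0 := nonZeroDivisors.ne_zero s.mem
  refine ⟨N, Pm, emb, hemb, gen, t₀ * s.val * b, mul_ne_zero (mul_ne_zero ht₀ hs0) hb0,
    by rw [← hf]; exact HK, fun T _ _ _ ↦ ?_, fun L _ _ hunit hirr ↦ ?_⟩
  · rw [← hf]
    exact Hloc (t₀ * s.val * b) (dvd_mul_of_dvd_left (dvd_mul_right t₀ s.val) b)
      (mul_ne_zero (mul_ne_zero ht₀ hs0) hb0) T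
  · -- ### (7) the fibres over `L`-points of `D(t)` are birational
    rw [← hf]
    set jL : Spec (.of L) ⟶ Spec (.of A) := Spec.map (CommRingCat.ofHom (algebraMap A L)) with hjL
    -- the point factors through the stage `D(s)`
    have hunit_s : IsUnit (algebraMap A L s.val) :=
      isUnit_of_dvd_unit (map_dvd (algebraMap A L)
        (dvd_mul_of_dvd_left (dvd_mul_left s.val t₀) b)) hunit
    have hunit_b : IsUnit (algebraMap A L b) :=
      isUnit_of_dvd_unit (map_dvd (algebraMap A L) (dvd_mul_left b _)) hunit
    have hunit_t₀ : IsUnit (algebraMap A L t₀) :=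
      isUnit_of_dvd_unit (map_dvd (algebraMap A L)
        (dvd_mul_of_dvd_left (dvd_mul_right t₀ s.val) b)) hunit
    let φs : LocApprox.loc (nonZeroDivisors A) s →+* L := IsLocalization.Away.lift s.val hunit_s
    letI : Algebra (LocApprox.loc (nonZeroDivisors A) s) L := φs.toAlgebra
    haveI : IsScalarTower A (LocApprox.loc (nonZeroDivisors A) s) L :=
      IsScalarTower.of_algebraMap_eq fun r ↦ (IsLocalization.Away.lift_eq s.val hunit_s r).symm
    let D : SchemeOver A := (LocApprox.baseDiagram (nonZeroDivisors A)).obj s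
    have hD : D.hom = Spec.map (CommRingCat.ofHom (algebraMap A (LocApprox.loc (nonZeroDivisors A) s))) := rfl
    set jLs : Spec (.of L) ⟶ D.left := Spec.map (CommRingCat.ofHom φs) with hjLs
    have hfacL : jLs ≫ D.hom = jL := by
      rw [hD, hjLs, hjL, ← Spec.map_comp, ← CommRingCat.ofHom_comp]
      congr 2
      exact (IsScalarTower.algebraMap_eq A (LocApprox.loc (nonZeroDivisors A) s) L).symm
    -- the spread isomorphism `e`, base-changed to `Spec L`
    have he' : e.hom.left ≫ (snd P₂ D).left = (snd P₁ D).left := congrArg CommaMorphism.left he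
    let q₁ : (P₁ ⊗ D).left ⟶ D.left := (snd P₁ D).left
    let q₂ : (P₂ ⊗ D).left ⟶ D.left := (snd P₂ D).left
    have hq₁ : q₁ = pullback.snd P₁.hom D.hom := rfl
    have hq₂ : q₂ = pullback.snd P₂.hom D.hom := rfl
    haveI : IsIso e.hom.left :=
      ⟨⟨e.inv.left, by rw [← Over.comp_left, Iso.hom_inv_id, Over.id_left],
        by rw [← Over.comp_left, Iso.inv_hom_id, Over.id_left]⟩⟩
    let ψ : pullback q₁ jLs ⟶ pullback q₂ jLs :=
      pullback.map q₁ jLs q₂ jLs e.hom.left (𝟙 _) (𝟙 _) (by rw [Category.comp_id]; exact he'.symm)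
        (by rw [Category.comp_id, Category.id_comp])
    haveI : IsIso ψ := inferInstance
    have hψsnd : ψ ≫ pullback.snd q₂ jLs = pullback.snd q₁ jLs := by
      rw [pullback.lift_snd, Category.comp_id]
    -- the pasting isomorphisms `(P_i ×_A D) ×_D L ≅ P_i ×_A L`
    let a₁ : pullback q₁ jLs ≅ pullback P₁.hom jL :=
      (pullbackLeftPullbackSndIso P₁.hom D.hom jLs) ≪≫ pullback.congrHom rfl hfacL
    let a₂ : pullback q₂ jLs ≅ pullback P₂.hom jL :=
      (pullbackLeftPullbackSndIso P₂.hom D.hom jLs) ≪≫ pullback.congrHom rfl hfacL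
    have ha₁ : a₁.hom ≫ pullback.snd P₁.hom jL = pullback.snd q₁ jLs := by
      change ((pullbackLeftPullbackSndIso P₁.hom D.hom jLs).hom ≫ (pullback.congrHom rfl hfacL).hom) ≫ _ = _
      rw [Category.assoc, pullback.congrHom_hom, pullback.lift_snd, Category.comp_id,
        pullbackLeftPullbackSndIso_hom_snd]
      try rfl
    have ha₂ : a₂.hom ≫ pullback.snd P₂.hom jL = pullback.snd q₂ jLs := by
      change ((pullbackLeftPullbackSndIso P₂.hom D.hom jLs).hom ≫ (pullback.congrHom rfl hfacL).hom) ≫ _ = _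
      rw [Category.assoc, pullback.congrHom_hom, pullback.lift_snd, Category.comp_id,
        pullbackLeftPullbackSndIso_hom_snd]
      try rfl
    -- the fibres as open subschemes of `Pm ×_A L` and `P ×_A L`
    have sqW : IsPullback ((pullback.fst f jL) ∣_ W) (((pullback.fst f jL) ⁻¹ᵁ W).ι ≫ pullback.snd f jL)
        (W.ι ≫ f) jL :=
      (isPullback_morphismRestrict (pullback.fst f jL) W).paste_vert (IsPullback.of_hasPullback f jL)
    have sqU : IsPullback ((pullback.fst P.hom jL) ∣_ U) (((pullback.fst P.hom jL) ⁻¹ᵁ U).ι ≫ pullback.snd P.hom jL)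
        (U.ι ≫ P.hom) jL :=
      (isPullback_morphismRestrict (pullback.fst P.hom jL) U).paste_vert (IsPullback.of_hasPullback P.hom jL)
    let i₁ : (((pullback.fst f jL) ⁻¹ᵁ W : (pullback f jL).Opens) : Scheme.{u}) ≅ pullback P₁.hom jL :=
      sqW.isoIsPullback _ _ (IsPullback.of_hasPullback (W.ι ≫ f) jL)
    let i₂ : (((pullback.fst P.hom jL) ⁻¹ᵁ U : (pullback P.hom jL).Opens) : Scheme.{u}) ≅ pullback P₂.hom jL :=
      sqU.isoIsPullback _ _ (IsPullback.of_hasPullback (U.ι ≫ P.hom) jL)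
    have hi₁ : i₁.hom ≫ pullback.snd P₁.hom jL = ((pullback.fst f jL) ⁻¹ᵁ W).ι ≫ pullback.snd f jL :=
      sqW.isoIsPullback_hom_snd _ _ _
    have hi₂ : i₂.inv ≫ ((pullback.fst P.hom jL) ⁻¹ᵁ U).ι ≫ pullback.snd P.hom jL = pullback.snd P₂.hom jL :=
      sqU.isoIsPullback_inv_snd _ _ _
    -- the partial isomorphism
    let ι : (((pullback.fst f jL) ⁻¹ᵁ W : (pullback f jL).Opens) : Scheme.{u}) ≅
        (((pullback.fst P.hom jL) ⁻¹ᵁ U : (pullback P.hom jL).Opens) : Scheme.{u}) :=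
      i₁ ≪≫ a₁.symm ≪≫ asIso ψ ≪≫ a₂ ≪≫ i₂.symm
    have hι : ι.hom ≫ ((pullback.fst P.hom jL) ⁻¹ᵁ U).ι ≫ pullback.snd P.hom jL =
        ((pullback.fst f jL) ⁻¹ᵁ W).ι ≫ pullback.snd f jL := by
      change (i₁.hom ≫ a₁.inv ≫ ψ ≫ a₂.hom ≫ i₂.inv) ≫ _ ≫ _ = _
      simp only [Category.assoc]
      rw [hi₂, ha₂, hψsnd, ← ha₁, Iso.inv_hom_id_assoc, hi₁]
    -- densities
    have hUL : (SetLike.coe ((pullback.fst P.hom jL) ⁻¹ᵁ U)).Nonempty := by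
      have hb' : (algebraMap A L) b ≠ 0 := hunit_b.ne_zero
      obtain ⟨z⟩ := nonempty_pullback_of_subset_range P₂.hom hbU (algebraMap A L) hb'
      exact ⟨(i₂.inv z).1, (i₂.inv z).2⟩
    have hWL : (SetLike.coe ((pullback.fst f jL) ⁻¹ᵁ W)).Nonempty := by
      obtain ⟨z, hz⟩ := hUL
      exact ⟨(ι.inv ⟨z, hz⟩).1, (ι.inv ⟨z, hz⟩).2⟩
    -- `Pm ×_A L` is irreducible: a fibre of the geometrically irreducible family over `A[1/t₀]`
    haveI : IrreducibleSpace ↥(pullback f jL) := by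
      let T₀ : Type u := Localization.Away t₀
      obtain ⟨-, -, hgi⟩ := Hloc t₀ (dvd_refl t₀) ht₀ T₀
      let φ₀ : T₀ →+* L := IsLocalization.Away.lift t₀ hunit_t₀
      letI : Algebra T₀ L := φ₀.toAlgebra
      haveI : IsScalarTower A T₀ L :=
        IsScalarTower.of_algebraMap_eq fun r ↦ (IsLocalization.Away.lift_eq t₀ hunit_t₀ r).symm
      set jT₀ : Spec (.of T₀) ⟶ Spec (.of A) := Spec.map (CommRingCat.ofHom (algebraMap A T₀)) with hjT₀
      set jLT : Spec (.of L) ⟶ Spec (.of T₀) := Spec.map (CommRingCat.ofHom φ₀) with hjLT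
      have hfac₀ : jLT ≫ jT₀ = jL := by
        rw [hjT₀, hjLT, hjL, ← Spec.map_comp, ← CommRingCat.ofHom_comp]
        congr 2
        exact (IsScalarTower.algebraMap_eq A T₀ L).symm
      haveI := hgi
      haveI : Subsingleton ↥(Spec (CommRingCat.of L)) := inferInstanceAs (Subsingleton (PrimeSpectrum L))
      haveI : IrreducibleSpace ↥(pullback (pullback.snd f jT₀) jLT) :=
        GeometricallyIrreducible.irreducibleSpace_of_subsingleton (f := pullback.snd (pullback.snd f jT₀) jLT)
      let c : pullback (pullback.snd f jT₀) jLT ≅ pullback f jL :=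
        pullbackLeftPullbackSndIso f jT₀ jLT ≪≫ pullback.congrHom rfl hfac₀
      haveI : Nonempty ↥(pullback f jL) := by
        obtain ⟨z, -⟩ := hWL
        exact ⟨z⟩
      haveI : Nonempty ↥(pullback (pullback.snd f jT₀) jLT) := ⟨c.inv (Classical.arbitrary _)⟩
      exact c.inv.isOpenEmbedding.irreducibleSpace
    refine ⟨⟨(pullback.fst f jL) ⁻¹ᵁ W, ?_, (pullback.fst P.hom jL) ⁻¹ᵁ U, ?_, ι⟩, ?_⟩
    · exact ((pullback.fst f jL) ⁻¹ᵁ W).2.dense hWL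
    · exact ((pullback.fst P.hom jL) ⁻¹ᵁ U).2.dense hUL
    · change ι.hom ≫ ((pullback.fst P.hom jL) ⁻¹ᵁ U).ι ≫ pullback.snd P.hom jL =
        ((pullback.fst f jL) ⁻¹ᵁ W).ι ≫ pullback.snd f jL
      exact hι

end Literature.AlgebraicGeometry.Limits

end
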